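import Summits.AtomisticToContinuum.Crystallization.Theorems.ChartedZeroExcessLayeredLatticeLiouvilleZZZU
import Literature.Geometry.DiscreteGeometry.TwoShellGoodShells

/-!
# ChartedZeroExcess · LayeredLatticeLiouville ZZZVA (lens-2 g89 NODE 89 «LabelChain», part 1 of 3) — the leaf (UXᴸ) `OffTubeBulkExitP` of W2⁗ PROVED at the
# fat record door; the door W2⁵′ `[MCMC](ϑc) ⟸ (SC) ∧ (X1ᴸ) ∧ (X2ᴸ) ∧ (RGᴸ) ∧ (DWᴹ)`

Split for the 400-line cap by sections: part 1 (this file) = module docstring + ZZZV-1/2 (shadow shell, label lift); part 2 `…ZZZVB` = ZZZV-3/4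
(geometry, chain); part 3 `…ZZZV` = ZZZV-5/6 (the node, the doors).  One namespace; FQNs as in the monolith of record.

Route ChartedPlanarOrder, docket `stmt-AtomisticToContinuum-26636` (`Theses.ChartedPlanarOrder.ChartedZeroExcessLayered`), W2 line.  NODE 88 (tree
`…ZZZU`) left the energetic route of record at the door W2⁗ with the KINEMATIC, LJ-free, `y`-free, rotation-free leaf
(UXᴸ) `OffTubeBulkExitP … (121/25) (249/5000) (21/50) …`: «a core site `dB = 21/50`-far from its label forces, among the core sites, an `Rg = 121/25`-label
pair whose vector bond deviation exceeds `sb = 249/5000`».  THIS NODE PROVES IT (`offTubeBulkExitP_fat`, from the symbolic `offTubeBulkExitP_of_labelChain`),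
hence (BXᴸ)_fat and (TGᴸ)(10⁻⁴)_fat unconditionally (`offTubeBondExitP_fat'`, `offTubeRigidGapP_fat'`), and re-issues the door with `hUX` discharged
(`mildCoolMoatCorePG_W2'''''`).  Residual deciding leaves of the W2 line after this node: (X1ᴸ) `LabelTubeConvexityP`, (X2ᴸ) `LabelLoadedTubeAprioriP`,
(RGᴸ) `DeficitRigidityP` (all LJ-free) and the monotone (DWᴹ) `DeficitWellMinP` [+ (SC)].

LENS «structural dichotomy (special vs generic)».  SPECIAL class = configurations whose core labels form NO bond-scale hop (every `Rg`-label pair of core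
sites has deviation difference `≤ sb`): the THEOREM of this node is that the special class is REGISTERED (`dist (x, lab x) ≤ dB` on the whole core) — a
rigidity statement proved by a new mechanism, the LABEL CHAIN; GENERIC class = a hop exists, which is exactly the exit (BXᴸ) consumed by the motion
dichotomy of NODE 88.  No estimate is needed on the generic side: the dichotomy is the proof.

THE LABEL CHAIN (proof of `labelChain_exit`, contrapositive).  Assume no hop (★).  The far site `p₀` is hot (cool sites are `ε`-registered, `ε < dB`), so a
core site `k₁` is within `rΘ`; let `u := (p₀ − x₀)/‖p₀ − x₀‖`, `kᵤ ∈ K` maximise `⟪·, u⟫` (`K ⊆ core` is finite), `λ = R₀ := rΘ + 6/5`, `z := kᵤ + λu`.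
Then `dist (p₀, kᵤ)² ≤ rΘ² + q² ≤ R₀²` (`labelChain_start_sq`), `‖z − p₀‖ ≤ q + λ ≤ 63/4` (`labelChain_exit_norm`), and the segment `[p₀, z]` lies in
`ball (kᵤ, R₀)`.  Way-points `t_j := lab p₀ + (j/21)(z − p₀)`, `j ≤ 21`, spacing `Δ ≤ 3/4`.  WALK THE LABELS, not the atoms: from an established atom `p`
(label `c = lab p ∈ C`) the shadow crystal `C` offers a site `c′` bonded to `c` making `45°`-covering progress towards the current way-point
(`shadow_descent_step`: clean chart crystal `H` ⟶ `EnvClose` ⟶ `H₀` ⟶ placement; tree `exists_unit_inner_ge_of_pattern`), the squared label distance to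
the way-point dropping by `≥ 1/100` while it exceeds the capture radius `4/5` (`descent_gain`); and `c′ = lab p′` for a CONTACT `p′` of `p`
(`exists_contact_of_bonded_label`: the twelve contacts of `p` map injectively into the `≤ 12` bonded sites of `lab p` — `bonded_placed_le_twelve`, the
kissing number of the clean chart crystal read through the shadow — so the label is LOCALLY ONTO).  Under (★) each new atom is compared with the ANCHOR of
its block (label distance `≤ (Δ + 4/5) + (3Δ + 4/5) = 23/5 ≤ Rg`), so deviations drift by `≤ sb` per BLOCK of three segments (`labelChain_segment`,
`labelChain_blocks`): after `7` blocks the end atom `pe` has `‖e(pe) − e₀‖ ≤ 7·sb` and `dist (pe, z) ≤ 4/5 + 7·sb ≤ 23/20`, so `⟪pe − k, u⟫ ≥ λ − 23/20 >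
rΘ` for every `k ∈ K` (`labelChain_cap_far`): `pe` is COOL, hence registered, `‖e(pe)‖ ≤ ε`, and `‖e₀‖ ≤ ε + 7·sb ≤ dB` — contradiction.  All atoms met
stay within `R₁ = R₀ + 19/10` of `kᵤ` (core: `R₁ + 17/16 ≤ ρ`; zone: `< ℓ`).

CONSTANTS (fat door: `rΘ = 145/16`, `q = 4`, `ρ = 16`, `ℓ = 43/2`, `ε = 10⁻⁴`, `Rg = 121/25`, `sb = 249/5000`, `dB = 21/50`, `(σ, ϑr, Rs) = (17/20, 10⁻⁴, 5)`,
`aHi = 1`).  Regime of `offTubeBulkExitP_of_labelChain`: `q ≤ rΘ` ✓(4 ≤ 9.06) · `q² ≤ 2rΘ` ✓(16 ≤ 18.1) · `q + rΘ ≤ 14` ✓(13.06) · `rΘ + 5 ≤ ρ < ℓ`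
✓(14.06 ≤ 16 < 21.5) · `23/5 ≤ Rg` ✓(4.84) · `0 ≤ sb`, `7sb ≤ 7/20` ✓(0.3486) · `ε + 7sb ≤ dB` ✓(0.3487 ≤ 0.42).  Local scale `a ∈ [9/10, 1]`, step
tolerance `a/16 + ϑr`, capture radius `4/5`, `21` way-points, `7` blocks, hop depth `7`.

CRITIC ROW 1576 remarks answered: (3) end-point slack — the cap offset is `λ − rΘ = 6/5` against an end error `≤ 4/5 + 7sb ≤ 23/20` (margin `1/20`,
symbolic in the regime); (4) the hop count is stated in the shadow crystal's OWN bond metric: every chain link is a `C`-bond `0 < dist ≤ 17a/16 + ϑr ≤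
28/25` produced inside `C` by the shadow of the clean chart crystal (no lattice arithmetic in `(L, w)` or `(L′, w′)` coordinates); (5) hop pairs are
distinct core sites BY CONSTRUCTION of (★) from the negated conclusion (`i′ ≠ j′`), the equal-site case being `‖0‖ ≤ sb`.

NEW FREE INPUTS: none (no LJ, no prices; the node is kinematic).  TREE INPUTS: `exists_unit_inner_ge_of_pattern` (TW), `isTwoShellGoodSet_of_isDoorSetP`
(ZCA), `card_filter_norm_eq_one_of_twoShellPattern`, `norm_of_mem_twoShellPattern` (Literature `TwoShellGoodShells`), `isSep_placedCrystal`,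
`finite_inter_ball_of_isSep`, `setOf_μS_ne_zero`, `mem_iff_μS_singleton_ne_zero`, and the g88 glue `offTubeBondExitP_fat`, `offTubeRigidGapP_fat`,
`mildCoolMoatCorePG_W2''''` (ZZZU).  0 sorry; imports = tree `…ZZZU` + Literature `TwoShellGoodShells`; axioms standard.
-/

noncomputable section
open scoped BigOperators Classical InnerProductSpace RealInnerProductSpace
open MeasureTheory Set Metric Filter Topology
open Literature.Geometry.DiscreteGeometry (IsTwoShellGoodSet fccTwoShellPattern hcpTwoShellPattern card_filter_norm_eq_one_of_twoShellPattern
  norm_of_mem_twoShellPattern)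
open Literature.MathematicalPhysics.StatisticalMechanics (lennardJones)

namespace Summit.AtomisticToContinuum.Crystallization.Theorems.ChartedZeroExcessLayeredLatticeLiouville

open Summit.AtomisticToContinuum.Crystallization.Theorems.ChartedPlanarOrderRigidityDoor (E3 IsClean)
open Summit.AtomisticToContinuum.Crystallization.Theorems.ChartedPlanarOrderDensityDichotomy (μS IsSep)
open Summit.AtomisticToContinuum.Crystallization.Theorems.ChartedPlanarOrderCleanScaleP (IsCleanP IsDoorSetP)
open Summit.AtomisticToContinuum.Crystallization.Theorems.ChartedPlanarOrderMesoCut (LayeredHom EnvClose)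
open Summit.AtomisticToContinuum.Crystallization.Theorems.ChartedPlanarOrderDoorLayeredOsc (IsTwoShellAffineGood mem_iff_μS_singleton_ne_zero)

/-! ### ZZZV-1  The shadow crystal's first shell: a descent step towards any target, and at most twelve bonded sites -/

section ShadowShell

variable {σ ϑr Rs ε r rI ℓ : ℝ} {S K H : Set E3} {L' : E3 →L[ℝ] E3} {w' : ℤ → E3} {U : E3 ≃ₗᵢ[ℝ] E3} {t : E3}

/-- ★ **DESCENT STEP IN THE SHADOW CRYSTAL (PROVED).**  If every site of the chart crystal `H` is `(1/16, 9/10, 1)`-clean and `C = placedCrystal L′ w′ U t`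
is a cool shadow crystal of `H` (shadow radius `Rs ≥ 17/16`), then from every site `c ∈ C` and for every target `c + g` there is a site `c′ ∈ C` within
`a/16 + ϑr` of an IDEAL first-shell point `y` (`dist y c = a`, `a ∈ [9/10, 1]` the local scale) making the `45°` covering-angle progress
`dist (y, c + g)² ≤ ‖g‖² − √2·a·‖g‖ + a²` (tree `exists_unit_inner_ge_of_pattern`).  Mechanism: read `g` in crystal coordinates, pick the pattern vector
`v` within `45°` of it at the clean shadow point `x ∈ H` of `U (c − t)`, take the `H`-site `f v` and transport it back to `H₀` by `EnvClose` (translation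
only) and to space by the placement. [this file, g89] -/
theorem shadow_descent_step (hSC : IsCoolShadowCrystal σ ϑr Rs ε r rI ℓ S K H L' w' U t)
    (hH : ∀ x ∈ H, IsTwoShellGoodSet (1 / 16) (9 / 10) 1 H x) (hRs : 17 / 16 ≤ Rs) {c : E3} (hc : c ∈ placedCrystal L' w' U t) (g : E3) :
    ∃ a : ℝ, 9 / 10 ≤ a ∧ a ≤ 1 ∧ ∃ c' ∈ placedCrystal L' w' U t, ∃ y : E3,
      dist c' y ≤ a / 16 + ϑr ∧ dist y c = a ∧ dist y (c + g) ^ 2 ≤ ‖g‖ ^ 2 - Real.sqrt 2 * a * ‖g‖ + a ^ 2 := by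
  obtain ⟨-, -, hsh, -, -⟩ := hSC
  set x' : E3 := U (c - t) with hx'def
  have hx' : x' ∈ LayeredHom L' w' := hc
  obtain ⟨x, hx, hE⟩ := hsh x' hx'
  obtain ⟨a, ha1, ha2, A, P, f, hP, hf, -, -⟩ := hH x hx
  have ha0 : 0 < a := by linarith
  set Ae := A.toLinearIsometryEquiv rfl with hAe
  set d : E3 := U g with hd
  obtain ⟨v, hvP, hv1, hv⟩ := exists_unit_inner_ge_of_pattern hP (Ae.symm d)
  have hAd : A (Ae.symm d) = d := by
    have h := LinearIsometryEquiv.apply_symm_apply Ae d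
    rw [hAe, LinearIsometry.toLinearIsometryEquiv_apply] at h
    rw [hAe]
    exact h
  have hAv : ⟪d, A v⟫ = ⟪Ae.symm d, v⟫ := by rw [← A.inner_map_map (Ae.symm d) v, hAd]
  rw [LinearIsometryEquiv.norm_map] at hv
  obtain ⟨hfv, hfvd⟩ := hf v hvP
  have haAv : ‖a • A v‖ = a := by rw [norm_smul, A.norm_map, hv1, mul_one, Real.norm_eq_abs, abs_of_pos ha0]
  have hfvx : dist (f v) x ≤ Rs := by
    calc dist (f v) x ≤ dist (f v) (x + a • A v) + dist (x + a • A v) x := dist_triangle _ _ _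
      _ ≤ 1 / 16 * a + a := by
          refine add_le_add hfvd ?_
          rw [dist_eq_norm, add_sub_cancel_left, haAv]
      _ ≤ Rs := by linarith
  obtain ⟨h', hh', hh'd⟩ := hE.2 (f v) hfv hfvx
  have hcx : c = U.symm x' + t := by rw [hx'def, U.symm_apply_apply, sub_add_cancel]
  refine ⟨a, ha1, ha2, U.symm h' + t, ?_, c + U.symm (a • A v), ?_, ?_, ?_⟩
  · show U (U.symm h' + t - t) ∈ LayeredHom L' w'
    rw [add_sub_cancel_right, U.apply_symm_apply]
    exact hh'
  · -- `dist c′ y = ‖h′ − x′ − a•A v‖ ≤ ϑr + a/16`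
    have e1 : U.symm h' + t - (c + U.symm (a • A v)) = U.symm (h' - x' - a • A v) := by
      rw [hcx, map_sub, map_sub]; abel
    rw [dist_eq_norm, e1, LinearIsometryEquiv.norm_map]
    have e2 : h' - x' - a • A v = (h' - x' - (f v - x)) + (f v - (x + a • A v)) := by abel
    rw [e2]
    calc ‖h' - x' - (f v - x) + (f v - (x + a • A v))‖ ≤ ‖h' - x' - (f v - x)‖ + ‖f v - (x + a • A v)‖ := norm_add_le _ _
      _ ≤ ϑr + 1 / 16 * a := add_le_add (by rw [← dist_eq_norm]; exact hh'd) (by rw [← dist_eq_norm]; exact hfvd)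
      _ = a / 16 + ϑr := by ring
  · rw [dist_eq_norm, add_sub_cancel_left, LinearIsometryEquiv.norm_map, haAv]
  · -- the covering-angle progress
    have e1 : c + U.symm (a • A v) - (c + g) = U.symm (a • A v - d) := by
      rw [map_sub, hd, U.symm_apply_apply]; abel
    rw [dist_eq_norm, e1, LinearIsometryEquiv.norm_map]
    have hdg : ‖d‖ = ‖g‖ := by rw [hd, LinearIsometryEquiv.norm_map]
    have htv : ‖d‖ ≤ Real.sqrt 2 * ⟪d, A v⟫ := by rw [hAv]; exact hv
    have hsq : ‖a • A v - d‖ ^ 2 = a ^ 2 - 2 * a * ⟪d, A v⟫ + ‖d‖ ^ 2 := by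
      rw [norm_sub_sq_real, haAv, real_inner_smul_left, real_inner_comm d (A v)]; ring
    rw [hsq, ← hdg]
    have hs : Real.sqrt 2 * Real.sqrt 2 = 2 := Real.mul_self_sqrt (by norm_num)
    have h2 : Real.sqrt 2 * a * ‖d‖ ≤ 2 * a * ⟪d, A v⟫ := by
      have := mul_le_mul_of_nonneg_left htv (by positivity : (0 : ℝ) ≤ Real.sqrt 2 * a)
      calc Real.sqrt 2 * a * ‖d‖ ≤ Real.sqrt 2 * a * (Real.sqrt 2 * ⟪d, A v⟫) := this
        _ = Real.sqrt 2 * Real.sqrt 2 * a * ⟪d, A v⟫ := by ring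
        _ = 2 * a * ⟪d, A v⟫ := by rw [hs]
    linarith

/-- ★ **THE STEP ARITHMETIC (PROVED)**: local scale `a ∈ [9/10, 1]`, distance to the target `D ≥ 4/5`, tolerance `τ ≤ a/16 + 10⁻⁴`, ideal progress
`W² ≤ D² − √2·a·D + a²` (`W ≥ 0`): the new squared distance `(τ + W)²` is at most `D² − 1/100`. [this file, g89] -/
theorem descent_gain {a D τ W : ℝ} (ha1 : 9 / 10 ≤ a) (ha2 : a ≤ 1) (hD : 4 / 5 ≤ D) (hτ0 : 0 ≤ τ) (hτ : τ ≤ a / 16 + 1 / 10000) (hW0 : 0 ≤ W)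
    (hW : W ^ 2 ≤ D ^ 2 - Real.sqrt 2 * a * D + a ^ 2) : (τ + W) ^ 2 ≤ D ^ 2 - 1 / 100 := by
  have hs2 : (14142 / 10000 : ℝ) < Real.sqrt 2 := sqrt_two_window.1
  have hD0 : 0 ≤ D := by linarith
  have hW' : W ^ 2 ≤ D ^ 2 - 14142 / 10000 * a * D + a ^ 2 := by nlinarith [mul_nonneg (mul_nonneg (by linarith : (0:ℝ) ≤ a) hD0) (sub_nonneg.2 hs2.le)]
  have hWD : W ≤ D := by
    have h : W ^ 2 ≤ D ^ 2 := by nlinarith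
    have h' := Real.sqrt_le_sqrt h
    rwa [Real.sqrt_sq hW0, Real.sqrt_sq hD0] at h'
  nlinarith [mul_le_mul_of_nonneg_left hWD (by linarith : (0:ℝ) ≤ 2 * τ), mul_nonneg hτ0 hD0,
    mul_nonneg (sub_nonneg.2 hD) (by linarith : (0:ℝ) ≤ 14142 / 10000 * a - 2 * τ), mul_nonneg (sub_nonneg.2 ha1) (sub_nonneg.2 ha2)]

/-- ★ **AT MOST TWELVE BONDED SITES (PROVED)**: in a cool shadow crystal of a clean chart crystal (`Rs ≥ 28/25`, `ϑr ≤ 10⁻⁴`, `σ ≥ 1/2`), every site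
`c` has at most `12` sites `c′` at bond range `0 < dist ≤ 28/25` (`ϑr ≤ 10⁻⁴`), and they form a finite set.  Mechanism: shadow each bonded site into the clean
`3a/2`-environment of the shadow point `x ∈ H`; it lands in the FIRST window (`28/25 + ϑr < (√2 − 1/16)·(9/10)`), hence on one of the twelve first-shell
pattern images, injectively (`2ϑr < σ`). [this file, g89] -/
theorem bonded_placed_le_twelve (hSC : IsCoolShadowCrystal σ ϑr Rs ε r rI ℓ S K H L' w' U t)
    (hH : ∀ x ∈ H, IsTwoShellGoodSet (1 / 16) (9 / 10) 1 H x) (hRs : 28 / 25 ≤ Rs) (hϑr : ϑr ≤ 1 / 10000) (hσ : 1 / 2 ≤ σ)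
    {c : E3} (hc : c ∈ placedCrystal L' w' U t) :
    ({c' | c' ∈ placedCrystal L' w' U t ∧ IsBond c c'}).ncard ≤ 12 ∧ ({c' | c' ∈ placedCrystal L' w' U t ∧ IsBond c c'}).Finite := by
  obtain ⟨-, hsep, hsh, -, -⟩ := hSC
  set B : Set E3 := {c' | c' ∈ placedCrystal L' w' U t ∧ IsBond c c'} with hB
  have hBfin : B.Finite := by
    refine (finite_inter_ball_of_isSep (by linarith : (0 : ℝ) < σ) (isSep_placedCrystal U t hsep) c 2).subset ?_
    rintro c' ⟨hc', hb⟩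
    exact ⟨hc', mem_ball.2 (by linarith [hb.2, dist_comm c c'])⟩
  refine ⟨?_, hBfin⟩
  set x' : E3 := U (c - t) with hx'def
  have hx' : x' ∈ LayeredHom L' w' := hc
  obtain ⟨x, hx, hE⟩ := hsh x' hx'
  obtain ⟨a, ha1, ha2, A, P, f, hP, hf, hinj, hsurj⟩ := hH x hx
  have ha0 : 0 < a := by linarith
  -- crystal-coordinate reading of placed distances
  have hcd : ∀ c' : E3, dist (U (c' - t)) x' = dist c' c := fun c' => by rw [hx'def, U.dist_map, dist_sub_right]
  have key1 : ∀ c' ∈ B, ∃ h ∈ H, dist (U (c' - t) - x') (h - x) ≤ ϑr := fun c' hc' =>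
    hE.1 (U (c' - t)) hc'.1 (by rw [hcd]; linarith [hc'.2.2, dist_comm c c'])
  choose! hh hhH hhd using key1
  -- the shadow of a bonded site lies in the first window of `x`
  have hwin : ∀ c' ∈ B, |dist (hh c') x - dist c' c| ≤ ϑr := by
    intro c' hc'
    have h1 := hhd c' hc'
    rw [dist_eq_norm] at h1
    have h2 := abs_norm_sub_norm_le (U (c' - t) - x') (hh c' - x)
    rw [← dist_eq_norm, ← dist_eq_norm, hcd] at h2
    rw [abs_sub_comm]
    exact h2.trans h1
  have hne : ∀ c' ∈ B, hh c' ≠ x := by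
    intro c' hc' heq
    have h1 := hwin c' hc'
    rw [heq, dist_self] at h1
    have hcc' : σ ≤ dist c' c := by
      have hsepC := isSep_placedCrystal U t hsep
      exact hsepC c' hc'.1 c hc (fun e => (ne_of_gt hc'.2.1) (by rw [e, dist_self]))
    have := (abs_le.1 h1).1
    linarith
  have hle : ∀ c' ∈ B, dist (hh c') x ≤ 3 / 2 * a := by
    intro c' hc'
    have h1 := (abs_le.1 (hwin c' hc')).2
    have h2 : dist c' c ≤ 28 / 25 := by rw [dist_comm]; exact hc'.2.2
    linarith
  have key2 : ∀ c' ∈ B, ∃ v ∈ P, f v = hh c' := fun c' hc' => hsurj (hh c') (hhH c' hc') (hne c' hc') (hle c' hc')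
  choose! vv hvvP hvvf using key2
  -- the pattern vector is a FIRST-shell vector
  have hv1 : ∀ c' ∈ B, ‖vv c'‖ = 1 := by
    intro c' hc'
    rcases norm_of_mem_twoShellPattern hP (hvvP c' hc') with h1 | h2
    · exact h1
    · exfalso
      have hfd := (hf (vv c') (hvvP c' hc')).2
      rw [hvvf c' hc'] at hfd
      have hav : dist (x + a • A (vv c')) x = a * Real.sqrt 2 := by
        rw [dist_eq_norm, add_sub_cancel_left, norm_smul, A.norm_map, h2, Real.norm_eq_abs, abs_of_pos ha0]
      have htri : a * Real.sqrt 2 - 1 / 16 * a ≤ dist (hh c') x := by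
        have := dist_triangle (x + a • A (vv c')) (hh c') x
        rw [hav, dist_comm (x + a • A (vv c'))] at this
        linarith
      have h3 := (abs_le.1 (hwin c' hc')).2
      have h4 : dist c' c ≤ 28 / 25 := by rw [dist_comm]; exact hc'.2.2
      have hs2 : (14142 / 10000 : ℝ) < Real.sqrt 2 := sqrt_two_window.1
      nlinarith
  have hmaps : ∀ c' ∈ B, vv c' ∈ (↑(P.filter fun v => ‖v‖ = 1) : Set E3) := fun c' hc' =>
    Finset.mem_coe.2 (Finset.mem_filter.2 ⟨hvvP c' hc', hv1 c' hc'⟩)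
  have hinjv : InjOn vv B := by
    intro c₁ hc₁ c₂ hc₂ heq
    have hh12 : hh c₁ = hh c₂ := by rw [← hvvf c₁ hc₁, ← hvvf c₂ hc₂, heq]
    have hd1 := hhd c₁ hc₁
    have hd2 := hhd c₂ hc₂
    rw [hh12] at hd1
    have hclose : dist (U (c₁ - t)) (U (c₂ - t)) ≤ 2 * ϑr := by
      have := dist_triangle (U (c₁ - t) - x') (hh c₂ - x) (U (c₂ - t) - x')
      rw [dist_sub_right, dist_comm (hh c₂ - x)] at this
      linarith
    by_contra hne12
    have hneU : U (c₁ - t) ≠ U (c₂ - t) := fun e => hne12 (by simpa using U.injective e)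
    have := hsep _ hc₁.1 _ hc₂.1 hneU
    linarith
  have hcard := Set.ncard_le_ncard_of_injOn vv hmaps hinjv (Finset.finite_toSet _)
  rw [Set.ncard_coe_finset, card_filter_norm_eq_one_of_twoShellPattern hP] at hcard
  exact hcard

end ShadowShell

/-! ### ZZZV-2  Local label surjectivity: the bond label maps the twelve contacts of a zone-interior atom ONTO the bonded sites of its label -/

section Lift

variable {δ ε rΘ ℓ : ℝ} {S K C : Set E3} {lab : E3 → E3}

/-- ★★ **LOCAL LABEL SURJECTIVITY (PROVED)** — the kissing-number-twelve pigeonhole of the label chain.  In a `1`-door set, an atom `p` whose whole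
first shell lies in the `ℓ`-zone has twelve contacts (`isTwoShellGoodSet_of_isDoorSetP`); a bond label sends them injectively to bonded sites of `lab p`
(bonds to bonds, injective on the zone), of which there are at most twelve (`bonded_placed_le_twelve`, supplied as `hB`); so EVERY bonded site of `lab p`
is the label of a contact of `p` (`Set.surj_on_of_inj_on_of_ncard_le`). [this file, g89] -/
theorem exists_contact_of_bonded_label (hS : IsDoorSetP 1 δ S) (hlab : IsBondLabel ε rΘ ℓ S K C lab)
    (hB : ∀ c ∈ C, ({c' | c' ∈ C ∧ IsBond c c'}).ncard ≤ 12 ∧ ({c' | c' ∈ C ∧ IsBond c c'}).Finite)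
    {p : E3} (hp : p ∈ S) (hz : ∃ k ∈ K, dist p k + 17 / 16 < ℓ) {c' : E3} (hc' : c' ∈ C) (hb : IsBond (lab p) c') :
    ∃ p' ∈ S, IsBond p p' ∧ dist p p' ≤ 17 / 16 ∧ lab p' = c' := by
  obtain ⟨a, ha1, ha2, A, P, f, hP, hf, hinj, -⟩ := isTwoShellGoodSet_of_isDoorSetP hS hp
  have ha0 : 0 < a := by linarith
  obtain ⟨k, hk, hkℓ⟩ := hz
  have hpz : ∃ k ∈ K, dist p k < ℓ := ⟨k, hk, by linarith⟩
  set P₁ : Finset E3 := P.filter fun v => ‖v‖ = 1 with hP₁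
  set D : Set E3 := f '' (↑P₁ : Set E3) with hD
  -- the twelve contacts
  have hcontact : ∀ v ∈ P₁, f v ∈ S ∧ IsBond p (f v) ∧ dist p (f v) ≤ 17 / 16 ∧ ∃ k ∈ K, dist (f v) k < ℓ := by
    intro v hv
    obtain ⟨hvP, hv1⟩ := Finset.mem_filter.1 hv
    obtain ⟨hfS, hfd⟩ := hf v hvP
    have hav : dist (p + a • A v) p = a := by
      rw [dist_eq_norm, add_sub_cancel_left, norm_smul, A.norm_map, hv1, mul_one, Real.norm_eq_abs, abs_of_pos ha0]
    have hup : dist p (f v) ≤ a + 1 / 16 * a := by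
      have := dist_triangle (f v) (p + a • A v) p
      rw [hav] at this
      rw [dist_comm]; linarith
    have hlow : a - 1 / 16 * a ≤ dist p (f v) := by
      have := dist_triangle (p + a • A v) (f v) p
      rw [hav, dist_comm (p + a • A v) (f v)] at this
      rw [dist_comm]; linarith
    have h1716 : dist p (f v) ≤ 17 / 16 := by nlinarith
    refine ⟨hfS, ⟨by linarith, by linarith⟩, h1716, k, hk, ?_⟩
    calc dist (f v) k ≤ dist (f v) p + dist p k := dist_triangle _ _ _
      _ < ℓ := by rw [dist_comm]; linarith
  have hDcard : D.ncard = 12 := by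
    rw [hD, (hinj.mono (fun v hv => (Finset.mem_filter.1 (Finset.mem_coe.1 hv)).1)).ncard_image, Set.ncard_coe_finset,
      card_filter_norm_eq_one_of_twoShellPattern hP]
  set B : Set E3 := {c'' | c'' ∈ C ∧ IsBond (lab p) c''} with hBdef
  have hlabC : lab p ∈ C := hlab.1 p hp hpz
  obtain ⟨hB12, hBfin⟩ := hB (lab p) hlabC
  have hmaps : ∀ d ∈ D, lab d ∈ B := by
    rintro d ⟨v, hv, rfl⟩
    obtain ⟨hfS, hbond, -, hfz⟩ := hcontact v (Finset.mem_coe.1 hv)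
    exact ⟨hlab.1 _ hfS hfz, hlab.2.1 p hp (f v) hfS hpz hfz hbond⟩
  have hinjl : ∀ d₁ d₂ (h₁ : d₁ ∈ D) (h₂ : d₂ ∈ D), lab d₁ = lab d₂ → d₁ = d₂ := by
    rintro d₁ d₂ ⟨v₁, hv₁, rfl⟩ ⟨v₂, hv₂, rfl⟩ heq
    obtain ⟨h1S, -, -, h1z⟩ := hcontact v₁ (Finset.mem_coe.1 hv₁)
    obtain ⟨h2S, -, -, h2z⟩ := hcontact v₂ (Finset.mem_coe.1 hv₂)
    exact hlab.2.2.1 ⟨h1S, h1z⟩ ⟨h2S, h2z⟩ heq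
  have hsurj := Set.surj_on_of_inj_on_of_ncard_le (s := D) (t := B) (fun d _ => lab d) (fun d hd => hmaps d hd)
    (fun d₁ d₂ h₁ h₂ heq => hinjl d₁ d₂ h₁ h₂ heq) (by rw [hDcard]; exact hB12) hBfin
  obtain ⟨d, hd, hdc⟩ := hsurj c' ⟨hc', hb⟩
  obtain ⟨v, hv, rfl⟩ := hd
  obtain ⟨hfS, hbond, h1716, -⟩ := hcontact v (Finset.mem_coe.1 hv)
  exact ⟨f v, hfS, hbond, h1716, hdc.symm⟩

end Lift

end Summit.AtomisticToContinuum.Crystallization.Theorems.ChartedZeroExcessLayeredLatticeLiouville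

end
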